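import Mathlib
import Summits.Ventures.DiscreteObjects.Mahler.PowerSumBound

/-!
# Fejér–Riesz / Toeplitz power-sum cuts for the kernel census (venture `DiscreteObjects`, target L)

Cell `pub-namedobj`, seat `pub-namedobj-mahler-g13`. Framing: lottery ticket; floor = certified bounds/negative
ranges.

For a reciprocal root configuration — a multiset `s` of `d` nonzero half-roots `α`, the roots of
`P = ∏_{α∈s} (x-α)(x-1/α)` being `α, 1/α` — with `M(P) ≤ B`, `1 ≤ B`, and ANY real vector `v = (v₀,…,v_K)`:

  `0 ≤ d·λ₀ + ½ Σ_{k=1}^{K} λ_k · Re s_k + Σ_{k=1}^{K} |λ_k| · ((B^k + B^{-k})/2 - 1)`     (`trigCut_halfRoots`)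

where `λ₀ = Σ v_i²`, `λ_k = 2 Σ_i v_i v_{i+k}` are the coefficients of the nonnegative cosine polynomial
`|Σ_j v_j e^{ijθ}|² = λ₀ + Σ_k λ_k cos kθ` and `s_k = Σ_{α∈s} (α^k + α^{-k})` is the `k`-th power sum of the roots.
The elementary test `|s_k| < 2d - 2 + B^k + B^{-k}` of mahler g2 (`powerSum_bound`) is the member `v = (1, 0, …, ±1)`;
the family as a whole says that `(Re s_k / 2)_k`, up to the slack `(B^k+B^{-k})/2 - 1`, is `d` times a cosine-moment
sequence of a measure on the circle (the roots of a small-measure reciprocal polynomial lie near the unit circle), which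
prunes the census search tree by a factor ≈ 20 at degree 14.

Proof: write `α = r ω`, `r = ‖α‖`, `‖ω‖ = 1`; then `Re(α^k + α^{-k}) = (r^k + r^{-k}) Re ω^k`, so the `α`-term of the
left side is `|Σ v_j ω^j|² + Σ_k λ_k ((r^k+r^{-k})/2 - 1) Re ω^k ≥ -Σ_k |λ_k| (cosh(k |log r|) - 1)`, and
`Σ_α (cosh(k|log ‖α‖|) - 1) ≤ cosh(k log M) - 1 ≤ (B^k+B^{-k})/2 - 1` by `sum_cosh_le` / `mahlerMeasure_halfRoots`.
-/

namespace Summit.Ventures.DiscreteObjects.Mahler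

open Polynomial

/-! ## Autocorrelation coefficients -/

/-- `λ₀(v) = Σ_i v_i²`. -/
def lamZero {R : Type*} [CommRing R] (v : List R) : R := (v.map fun x => x * x).sum

/-- `λ_k(v) = 2 Σ_i v_i v_{i+k}`. -/
def lamAt {R : Type*} [CommRing R] (v : List R) (k : ℕ) : R := 2 * (List.zipWith (· * ·) v (v.drop k)).sum

/-- `λ₀` of a cons. -/
theorem lamZero_cons {R : Type*} [CommRing R] (a : R) (w : List R) : lamZero (a :: w) = a * a + lamZero w := by
  simp [lamZero]

/-- `λ_k = 0` beyond the length. -/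
theorem lamAt_eq_zero_of_le {R : Type*} [CommRing R] (w : List R) {k : ℕ} (h : w.length ≤ k) : lamAt w k = 0 := by
  unfold lamAt
  rw [List.drop_eq_nil_of_le h, List.zipWith_nil_right, List.sum_nil, mul_zero]

/-- `λ_{k+1}(a :: w) = 2 a w_k + λ_{k+1}(w)`. -/
theorem lamAt_cons_succ {R : Type*} [CommRing R] (a : R) (w : List R) (k : ℕ) :
    lamAt (a :: w) (k + 1) = 2 * a * w.getD k 0 + lamAt w (k + 1) := by
  unfold lamAt
  rw [List.drop_succ_cons]
  by_cases hk : k < w.length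
  · rw [List.drop_eq_getElem_cons hk, List.zipWith_cons_cons, List.sum_cons, List.getD_eq_getElem _ _ hk]
    ring
  · push Not at hk
    rw [List.drop_eq_nil_of_le hk, List.drop_eq_nil_of_le (by omega), List.zipWith_nil_right,
      List.zipWith_nil_right, List.sum_nil, List.getD_eq_default _ _ hk]
    ring

/-- Casting a `zipWith (· * ·)` sum from `ℤ` to `ℝ`. -/
theorem sum_zipWith_mul_cast (l m : List ℤ) :
    (List.zipWith (· * ·) (l.map (Int.cast : ℤ → ℝ)) (m.map (Int.cast : ℤ → ℝ))).sum =
      (((List.zipWith (· * ·) l m).sum : ℤ) : ℝ) := by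
  induction l generalizing m with
  | nil => simp
  | cons a l ih =>
    cases m with
    | nil => simp
    | cons b m => rw [List.map_cons, List.map_cons, List.zipWith_cons_cons, List.zipWith_cons_cons, List.sum_cons,
        List.sum_cons, ih m]; push_cast; ring

/-- Casting `λ₀` from `ℤ` to `ℝ`. -/
theorem lamZero_map_cast (v : List ℤ) : lamZero (v.map (Int.cast : ℤ → ℝ)) = (((lamZero v : ℤ)) : ℝ) := by
  induction v with
  | nil => simp [lamZero]
  | cons a w ih => rw [List.map_cons, lamZero_cons, lamZero_cons, ih]; push_cast; ring

/-- Casting `λ_k` from `ℤ` to `ℝ`. -/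
theorem lamAt_map_cast (v : List ℤ) (k : ℕ) : lamAt (v.map (Int.cast : ℤ → ℝ)) k = (((lamAt v k : ℤ)) : ℝ) := by
  unfold lamAt
  rw [← List.map_drop, sum_zipWith_mul_cast]; push_cast; ring

/-! ## The nonnegative cosine polynomial `|Σ v_j ω^j|²` -/

/-- `V(ω) = Σ_j v_j ω^j`, by Horner. -/
def vEval : List ℝ → ℂ → ℂ
  | [], _ => 0
  | a :: w, ω => (a : ℂ) + ω * vEval w ω

/-- `Re(ω^m · V_w(ω)) = Σ_{k<|w|} w_k Re ω^{m+k}`. -/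
theorem re_pow_mul_vEval (w : List ℝ) (ω : ℂ) (m : ℕ) :
    (ω ^ m * vEval w ω).re = ∑ k ∈ Finset.range w.length, w.getD k 0 * (ω ^ (m + k)).re := by
  induction w generalizing m with
  | nil => simp [vEval]
  | cons b u ih =>
    rw [vEval, mul_add, Complex.add_re, List.length_cons, Finset.sum_range_succ', List.getD_cons_zero,
      Nat.add_zero, ← mul_assoc, ← pow_succ, ih (m + 1)]
    have h1 : (ω ^ m * (b : ℂ)).re = b * (ω ^ m).re := by
      rw [mul_comm, Complex.re_ofReal_mul]
    rw [h1, add_comm]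
    congr 1
    apply Finset.sum_congr rfl
    intro k _
    rw [List.getD_cons_succ, show m + 1 + k = m + (k + 1) by ring]

/-- **Fejér–Riesz (easy direction).** On the unit circle, `|V(ω)|² = λ₀ + Σ_{k≥1} λ_k Re ω^k`. -/
theorem normSq_vEval (v : List ℝ) {ω : ℂ} (hω : ‖ω‖ = 1) :
    Complex.normSq (vEval v ω) =
      lamZero v + ∑ k ∈ Finset.range v.length, lamAt v (k + 1) * (ω ^ (k + 1)).re := by
  induction v with
  | nil => simp [vEval, lamZero]
  | cons a w ih =>
    have hE : Complex.normSq (vEval (a :: w) ω) =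
        a * a + Complex.normSq (vEval w ω) + 2 * a * (ω * vEval w ω).re := by
      rw [vEval, Complex.normSq_add, Complex.normSq_ofReal, Complex.normSq_mul, Complex.normSq_eq_norm_sq ω, hω,
        one_pow, one_mul, Complex.re_ofReal_mul, Complex.conj_re]
      ring
    rw [hE, ih, lamZero_cons, List.length_cons, Finset.sum_range_succ, lamAt_cons_succ a w w.length,
      List.getD_eq_default _ _ le_rfl, lamAt_eq_zero_of_le w (Nat.le_succ _), mul_zero, zero_add, zero_mul, add_zero]
    have hsplit : ∑ k ∈ Finset.range w.length, lamAt (a :: w) (k + 1) * (ω ^ (k + 1)).re =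
        2 * a * ∑ k ∈ Finset.range w.length, w.getD k 0 * (ω ^ (1 + k)).re +
          ∑ k ∈ Finset.range w.length, lamAt w (k + 1) * (ω ^ (k + 1)).re := by
      rw [Finset.mul_sum, ← Finset.sum_add_distrib]
      apply Finset.sum_congr rfl
      intro k _
      rw [lamAt_cons_succ, show 1 + k = k + 1 from Nat.add_comm 1 k]
      ring
    rw [hsplit, ← re_pow_mul_vEval w ω 1, pow_one]
    ring

/-- Nonnegativity of the cosine polynomial on the unit circle. -/
theorem trigPoly_nonneg (v : List ℝ) {ω : ℂ} (hω : ‖ω‖ = 1) :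
    0 ≤ lamZero v + ∑ k ∈ Finset.range v.length, lamAt v (k + 1) * (ω ^ (k + 1)).re := by
  rw [← normSq_vEval v hω]; exact Complex.normSq_nonneg _

/-! ## One half-root -/

/-- `(r^k + r^{-k})/2 - 1 ≥ 0` for `r > 0`. -/
theorem half_pow_add_inv_sub_one_nonneg {r : ℝ} (hr : 0 < r) (k : ℕ) : 0 ≤ (r ^ k + (r ^ k)⁻¹) / 2 - 1 := by
  have hx : 0 < r ^ k := pow_pos hr k
  have key : (r ^ k + (r ^ k)⁻¹) / 2 - 1 = (r ^ k - 1) ^ 2 / (2 * r ^ k) := by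
    field_simp
    ring
  rw [key]; positivity

/-- `Re(α^k + α^{-k}) = (r^k + r^{-k}) · Re ω^k` for `α = r ω`, `r = ‖α‖ > 0`, `ω = α/r`. -/
theorem re_pow_add_inv_pow {α : ℂ} (hα : α ≠ 0) (k : ℕ) :
    (α ^ k + α⁻¹ ^ k).re = (‖α‖ ^ k + (‖α‖ ^ k)⁻¹) * ((((‖α‖⁻¹ : ℝ) : ℂ) * α) ^ k).re := by
  have hr : 0 < ‖α‖ := norm_pos_iff.mpr hα
  set ω : ℂ := ((‖α‖⁻¹ : ℝ) : ℂ) * α with hω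
  have hωn : ‖ω‖ = 1 := by
    rw [hω, norm_mul, Complex.norm_real, Real.norm_eq_abs, abs_of_pos (inv_pos.mpr hr), inv_mul_cancel₀ hr.ne']
  have hαω : α = ((‖α‖ : ℝ) : ℂ) * ω := by
    rw [hω, ← mul_assoc, ← Complex.ofReal_mul, mul_inv_cancel₀ hr.ne', Complex.ofReal_one, one_mul]
  have hωinv : ω⁻¹ = (starRingEnd ℂ) ω := by
    rw [Complex.inv_def, Complex.normSq_eq_norm_sq, hωn]; simp
  have h1 : (α ^ k).re = ‖α‖ ^ k * (ω ^ k).re := by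
    conv_lhs => rw [hαω, mul_pow, ← Complex.ofReal_pow, Complex.re_ofReal_mul]
  have h2 : (α⁻¹ ^ k).re = (‖α‖ ^ k)⁻¹ * (ω ^ k).re := by
    conv_lhs => rw [hαω, mul_inv, ← Complex.ofReal_inv, mul_pow, ← Complex.ofReal_pow, Complex.re_ofReal_mul, hωinv,
      ← map_pow, Complex.conj_re, inv_pow]
  rw [Complex.add_re, h1, h2]; ring

/-- **The cut, one half-root.** For `α ≠ 0` and any real `v`:
`λ₀ + Σ_k λ_k · Re(α^k+α^{-k})/2 ≥ -Σ_k |λ_k| ((‖α‖^k + ‖α‖^{-k})/2 - 1)`. -/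
theorem trigCut_one (v : List ℝ) {α : ℂ} (hα : α ≠ 0) :
    -(∑ k ∈ Finset.range v.length, |lamAt v (k + 1)| * ((‖α‖ ^ (k + 1) + (‖α‖ ^ (k + 1))⁻¹) / 2 - 1)) ≤
      lamZero v + ∑ k ∈ Finset.range v.length, lamAt v (k + 1) * ((α ^ (k + 1) + α⁻¹ ^ (k + 1)).re / 2) := by
  have hr : 0 < ‖α‖ := norm_pos_iff.mpr hα
  set ω : ℂ := ((‖α‖⁻¹ : ℝ) : ℂ) * α with hω
  have hωn : ‖ω‖ = 1 := by
    rw [hω, norm_mul, Complex.norm_real, Real.norm_eq_abs, abs_of_pos (inv_pos.mpr hr), inv_mul_cancel₀ hr.ne']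
  have h0 := trigPoly_nonneg v hωn
  -- termwise: λ_k Re(..)/2 = λ_k Re ω^k + λ_k (c_k - 1) Re ω^k ≥ λ_k Re ω^k - |λ_k| (c_k - 1)
  have hterm : ∀ k ∈ Finset.range v.length,
      lamAt v (k + 1) * (ω ^ (k + 1)).re - |lamAt v (k + 1)| * ((‖α‖ ^ (k + 1) + (‖α‖ ^ (k + 1))⁻¹) / 2 - 1) ≤
        lamAt v (k + 1) * ((α ^ (k + 1) + α⁻¹ ^ (k + 1)).re / 2) := by
    intro k _
    rw [re_pow_add_inv_pow hα (k + 1)]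
    set c := (‖α‖ ^ (k + 1) + (‖α‖ ^ (k + 1))⁻¹) / 2 with hc
    set x := (ω ^ (k + 1)).re with hx
    have hc1 : 0 ≤ c - 1 := half_pow_add_inv_sub_one_nonneg hr (k + 1)
    have hx1 : |x| ≤ 1 := by
      rw [hx]; calc |(ω ^ (k + 1)).re| ≤ ‖ω ^ (k + 1)‖ := Complex.abs_re_le_norm _
        _ = 1 := by rw [norm_pow, hωn, one_pow]
    have key : lamAt v (k + 1) * ((‖α‖ ^ (k + 1) + (‖α‖ ^ (k + 1))⁻¹) * x / 2) =
        lamAt v (k + 1) * x + (lamAt v (k + 1) * x) * (c - 1) := by rw [hc]; ring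
    rw [key]
    have h3 : -(|lamAt v (k + 1)| * (c - 1)) ≤ (lamAt v (k + 1) * x) * (c - 1) := by
      have h4 : |lamAt v (k + 1) * x| ≤ |lamAt v (k + 1)| := by
        rw [abs_mul]; exact mul_le_of_le_one_right (abs_nonneg _) hx1
      have h5 := neg_abs_le (lamAt v (k + 1) * x)
      nlinarith
    linarith
  have hsum := Finset.sum_le_sum hterm
  rw [Finset.sum_sub_distrib] at hsum
  linarith

/-! ## Summing over the configuration -/

/-- `(r^k + r^{-k})/2 = cosh(k |log r|)` for `r > 0`. -/
theorem half_pow_add_inv_eq_cosh {r : ℝ} (hr : 0 < r) (k : ℕ) :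
    (r ^ k + (r ^ k)⁻¹) / 2 = Real.cosh (k * |Real.log r|) := by
  rw [← abs_of_nonneg (Nat.cast_nonneg k : (0:ℝ) ≤ k), ← abs_mul, Real.cosh_abs, Real.cosh_eq, ← Real.log_pow,
    Real.exp_neg, Real.exp_log (pow_pos hr k)]

/-- Exchange of a multiset sum with a finite sum. -/
theorem multiset_sum_finset_sum {ι : Type*} (s : Multiset ι) (n : ℕ) (f : ι → ℕ → ℝ) :
    (s.map fun i => ∑ k ∈ Finset.range n, f i k).sum = ∑ k ∈ Finset.range n, (s.map fun i => f i k).sum := by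
  induction s using Multiset.induction_on with
  | empty => simp
  | cons a t ih => simp [Multiset.map_cons, Multiset.sum_cons, ih, Finset.sum_add_distrib]

/-- The slack sums: `Σ_{α∈s} ((‖α‖^k+‖α‖^{-k})/2 - 1) ≤ (M^k + M^{-k})/2 - 1`, `M = M(∏(x-α)(x-1/α))`. -/
theorem sum_slack_le (s : Multiset ℂ) (hs : ∀ α ∈ s, α ≠ 0) (k : ℕ) :
    (s.map fun α => (‖α‖ ^ k + (‖α‖ ^ k)⁻¹) / 2 - 1).sum ≤
      ((s.map fun α => ((X - C α) * (X - C α⁻¹) : ℂ[X])).prod.mahlerMeasure ^ k +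
        ((s.map fun α => ((X - C α) * (X - C α⁻¹) : ℂ[X])).prod.mahlerMeasure ^ k)⁻¹) / 2 - 1 := by
  rw [mahlerMeasure_halfRoots s hs]
  by_cases hne : s = 0
  · subst hne
    simp only [Multiset.map_zero, Multiset.sum_zero, Real.exp_zero, one_pow, inv_one]
    norm_num
  set w : Multiset ℝ := s.map fun α => (k : ℝ) * |Real.log ‖α‖| with hw
  have hwnn : ∀ x ∈ w, 0 ≤ x := by
    intro x hx; rw [hw] at hx
    obtain ⟨α, _, rfl⟩ := Multiset.mem_map.mp hx
    positivity
  have hwne : w ≠ 0 := by rw [hw]; simpa using hne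
  have h1 : (s.map fun α => (‖α‖ ^ k + (‖α‖ ^ k)⁻¹) / 2 - 1).sum = (w.map Real.cosh).sum - Multiset.card s := by
    have : (s.map fun α => (‖α‖ ^ k + (‖α‖ ^ k)⁻¹) / 2 - 1) = s.map fun α => Real.cosh (k * |Real.log ‖α‖|) - 1 :=
      Multiset.map_congr rfl fun α hα => by rw [half_pow_add_inv_eq_cosh (norm_pos_iff.mpr (hs α hα))]
    rw [this, Multiset.sum_map_sub, hw, Multiset.map_map]
    simp
  have h2 := sum_cosh_le w hwnn hwne
  have hcard : (Multiset.card w : ℝ) = Multiset.card s := by rw [hw, Multiset.card_map]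
  have h3 : Real.cosh w.sum = (Real.exp (s.map fun α => |Real.log ‖α‖|).sum ^ k +
      (Real.exp (s.map fun α => |Real.log ‖α‖|).sum ^ k)⁻¹) / 2 := by
    rw [Real.cosh_eq, ← Real.exp_nat_mul, ← Real.exp_neg]
    congr 2
    · rw [hw, Multiset.sum_map_mul_left]
    · rw [hw, Multiset.sum_map_mul_left]
  rw [h1, ← h3]
  rw [hcard] at h2
  linarith

/-- `x ↦ x^k + x^{-k}` is monotone on `[1, ∞)`. -/
theorem pow_add_inv_pow_le {x y : ℝ} (hx : 1 ≤ x) (hxy : x ≤ y) (k : ℕ) :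
    x ^ k + (x ^ k)⁻¹ ≤ y ^ k + (y ^ k)⁻¹ := by
  rcases eq_or_lt_of_le hxy with rfl | hlt
  · exact le_rfl
  · cases k with
    | zero => simp
    | succ k => exact (pow_add_inv_pow_lt hx hlt (Nat.succ_pos k)).le

/-- **The Fejér–Riesz / Toeplitz cut for a reciprocal root configuration.** For nonzero half-roots `s` with
`M(∏(x-α)(x-1/α)) ≤ B` and any real `v = (v₀,…,v_K)`:
`0 ≤ |s|·λ₀ + Σ_{k=1}^{K} λ_k · Re(Σ_α (α^k+α^{-k}))/2 + Σ_{k=1}^{K} |λ_k| ((B^k + B^{-k})/2 - 1)`. -/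
theorem trigCut_halfRoots (s : Multiset ℂ) (hs : ∀ α ∈ s, α ≠ 0) (v : List ℝ) {B : ℝ}
    (hB : (s.map fun α => ((X - C α) * (X - C α⁻¹) : ℂ[X])).prod.mahlerMeasure ≤ B) :
    0 ≤ (Multiset.card s : ℝ) * lamZero v +
      ∑ k ∈ Finset.range v.length, lamAt v (k + 1) * (((s.map fun α => α ^ (k + 1) + α⁻¹ ^ (k + 1)).sum).re / 2) +
      ∑ k ∈ Finset.range v.length, |lamAt v (k + 1)| * ((B ^ (k + 1) + (B ^ (k + 1))⁻¹) / 2 - 1) := by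
  set P := (s.map fun α => ((X - C α) * (X - C α⁻¹) : ℂ[X])).prod with hP
  have hmonic : P.Monic := by
    rw [hP]; apply monic_multiset_prod_of_monic; intro α _
    exact (monic_X_sub_C _).mul (monic_X_sub_C _)
  have hM1 : 1 ≤ P.mahlerMeasure := by
    apply one_le_mahlerMeasure_of_one_le_norm_leadingCoeff
    rw [hmonic.leadingCoeff, norm_one]
  -- sum the one-root cuts
  have hone : ∀ α ∈ s, -(∑ k ∈ Finset.range v.length,
      |lamAt v (k + 1)| * ((‖α‖ ^ (k + 1) + (‖α‖ ^ (k + 1))⁻¹) / 2 - 1)) ≤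
      lamZero v + ∑ k ∈ Finset.range v.length, lamAt v (k + 1) * ((α ^ (k + 1) + α⁻¹ ^ (k + 1)).re / 2) :=
    fun α hα => trigCut_one v (hs α hα)
  have hsum := Multiset.sum_map_le_sum_map _ _ hone
  -- left side: -Σ_k |λ_k| Σ_α slack_α ≥ -Σ_k |λ_k| slack(B)
  rw [Multiset.sum_map_neg, multiset_sum_finset_sum] at hsum
  rw [Multiset.sum_map_add, multiset_sum_finset_sum] at hsum
  simp only [Multiset.sum_map_mul_left, Multiset.map_const', Multiset.sum_replicate, nsmul_eq_mul] at hsum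
  have hslack : ∀ k ∈ Finset.range v.length,
      |lamAt v (k + 1)| * (s.map fun α => (‖α‖ ^ (k + 1) + (‖α‖ ^ (k + 1))⁻¹) / 2 - 1).sum ≤
        |lamAt v (k + 1)| * ((B ^ (k + 1) + (B ^ (k + 1))⁻¹) / 2 - 1) := by
    intro k _
    apply mul_le_mul_of_nonneg_left _ (abs_nonneg _)
    have h1 := sum_slack_le s hs (k + 1)
    rw [← hP] at h1
    have h2 := pow_add_inv_pow_le hM1 hB (k + 1)
    linarith
  have hslack' := Finset.sum_le_sum hslack
  have hre : ∀ k ∈ Finset.range v.length,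
      lamAt v (k + 1) * (s.map fun α => (α ^ (k + 1) + α⁻¹ ^ (k + 1)).re / 2).sum =
        lamAt v (k + 1) * (((s.map fun α => α ^ (k + 1) + α⁻¹ ^ (k + 1)).sum).re / 2) := by
    intro k _
    have hre_sum : ((s.map fun α => α ^ (k + 1) + α⁻¹ ^ (k + 1)).sum).re =
        (s.map fun α => (α ^ (k + 1) + α⁻¹ ^ (k + 1)).re).sum := by
      have h := map_multiset_sum Complex.reAddGroupHom (s.map fun α => α ^ (k + 1) + α⁻¹ ^ (k + 1))
      rw [Multiset.map_map] at h
      exact h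
    rw [hre_sum, Multiset.sum_map_div]
  rw [Finset.sum_congr rfl hre] at hsum
  linarith

end Summit.Ventures.DiscreteObjects.Mahler
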